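import Summits.AnomalousDissipation.AnomalousDissipation.Theorems.MomentParityCubicParityLoudBalancedMenuAtoms
import Summits.AnomalousDissipation.AnomalousDissipation.Theorems.MomentParityCubicParityLoudBalancedMenuPieces
import Summits.AnomalousDissipation.AnomalousDissipation.Theorems.MomentParityCubicParityLoudBalancedMenuPacketSolve
import Summits.AnomalousDissipation.AnomalousDissipation.Theorems.MomentParityCubicParityLoudBalancedMenuLattice
import Summits.AnomalousDissipation.AnomalousDissipation.Theorems.MomentParityCubicParityLoudBalancedMenuDecay

/-!
# The balanced menu design: mean flow, stress packets, chiral sea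

Helper file for stub S5 (`stub_balancedMenu`), line `farkas-split-menu`, crux `MomentParity.CubicParityLoud`
(stmt-AnomalousDissipation-11465). For a smooth divergence-free force `f` and a forced frequency `p₀ ≠ 0` this file
ASSEMBLES the atom cloud of the balanced menu at level `N`, viscosity `ν ∈ [0,1]`, shell radius `1 ≤ K ≤ N` and sea
amplitudes `A₊, A₋`: the MEAN FLOW `m = δ_{p₀} f̂(p₀) + δ_{-p₀} \overline{f̂(p₀)}`; for every momentum `q` of the
punctured ball the two STRESS PACKETS of `…BalancedMenuLattice` / `…BalancedMenuPacketSolve` (each with its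
quarter-turn), realising half of the residual `T(q) = f̂(q) - 4π²ν|q|² m̂(q)`, so that by the resummation of
`…BalancedMenuPieces` the sign-averaged Reynolds stress is exactly `T` and EVERY LINEAR ROW VANISHES
(`…BalancedMenuAtoms`); the CHIRAL SEA, two helical pairs at `(K,0,0)` with amplitudes `A₊ (0,1,i)`, `A₋ (0,1,-i)`.
Output (`balancedMenu_design`): helicity offsets `H₀, H₁` of the mean flow, a uniform bound `C` for the packet
enstrophy `Z_P ≥` packet energy `E_P` (Sobolev weights of `f`, `…BalancedMenuDecay`), and the rows: energy drift
`2‖f̂(p₀)‖² - 4π²ν (2|p₀|²‖f̂(p₀)‖² + Z_P + 4K²(A₊² + A₋²))`, helicity drift `H₀ + ν (H₁ - 32π³K³A₊² + 32π³K³A₋²)`,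
energy `2‖f̂(p₀)‖² + E_P + 4(A₊² + A₋²)`, dissipation `4π²ν (2|p₀|²‖f̂(p₀)‖² + Z_P + 4K²(A₊² + A₋²))`.
-/

noncomputable section

namespace Summit.AnomalousDissipation.AnomalousDissipation.Theorems.MomentParityCubicParityLoud

open MeasureTheory Finset Complex UnitAddTorus Matrix
open scoped ComplexConjugate ENNReal
open Literature.Analysis.FunctionSpaces Literature.Analysis.FluidPDE
open Summit.AnomalousDissipation.AnomalousDissipation.Theorems.MomentParityQuarticGate
open Summit.AnomalousDissipation.AnomalousDissipation.Theorems.CubicParityLoud.Negative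

set_option linter.dupNamespace false

/-- **THE BALANCED MENU DESIGN** (see the module docstring). [folklore] -/
theorem balancedMenu_design_aux {f : T3 → R3} (hf : Torus.IsSmooth f) (hdiv : Torus.IsDivFree f)
    {p₀ : Fin 3 → ℤ} (hp₀ : p₀ ≠ 0) :
    ∃ H₀ H₁ C : ℝ, 0 ≤ C ∧ ∀ (N K : ℕ) (ν : ℝ), 0 ≤ ν → ν ≤ 1 → 1 ≤ K → K ≤ N → 2 ≤ N →
      Torus.freqNormSq p₀ ≤ (N : ℝ) ^ 2 →
      ∃ ZP EP : ℝ, 0 ≤ EP ∧ EP ≤ ZP ∧ ZP ≤ C ∧ ∀ Ap An : ℝ, ∃ μ : Measure H3,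
        IsProbabilityMeasure μ ∧ (∀ᵐ u ∂μ, IsLevel N u) ∧ Integrable (fun u : H3 => ‖u‖ ^ 3) μ ∧
        (∀ g : T3 → R3, IsBandTest N g →
            Integrable (fun u : H3 => Torus.nsGeneratorPairing ν f u g) μ ∧
              ∫ u, Torus.nsGeneratorPairing ν f u g ∂μ = 0) ∧
        (Integrable (fun u : H3 => Torus.nsGeneratorPairing ν f u
            (Torus.fourierTruncate N ((u : L2T3) : T3 → R3))) μ ∧
          ∫ u, Torus.nsGeneratorPairing ν f u (Torus.fourierTruncate N ((u : L2T3) : T3 → R3)) ∂μ =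
            2 * ‖mFourierCoeff (EuclideanSpace.complexify ∘ f) p₀‖ ^ 2 -
              ν * (4 * Real.pi ^ 2 * (2 * (Torus.freqNormSq p₀ * ‖mFourierCoeff (EuclideanSpace.complexify ∘ f) p₀‖ ^ 2) +
                (ZP + (4 * (K : ℝ) ^ 2 * Ap ^ 2 + 4 * (K : ℝ) ^ 2 * An ^ 2))))) ∧
        (Integrable (fun u : H3 => Torus.nsGeneratorPairing ν f u
            (BDSV.curl (Torus.fourierTruncate N ((u : L2T3) : T3 → R3)))) μ ∧
          ∫ u, Torus.nsGeneratorPairing ν f u (BDSV.curl (Torus.fourierTruncate N ((u : L2T3) : T3 → R3))) ∂μ =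
            H₀ + ν * (H₁ + (-(1 : ℝ) * (32 * Real.pi ^ 3 * (K : ℝ) ^ 3 * Ap ^ 2) +
              -(-1 : ℝ) * (32 * Real.pi ^ 3 * (K : ℝ) ^ 3 * An ^ 2)))) ∧
        Torus.ensembleEnergy μ = 2 * ‖mFourierCoeff (EuclideanSpace.complexify ∘ f) p₀‖ ^ 2 +
          (EP + (4 * Ap ^ 2 + 4 * An ^ 2)) ∧
        Torus.ensembleDissipation ν μ =
          ν * (4 * Real.pi ^ 2 * (2 * (Torus.freqNormSq p₀ * ‖mFourierCoeff (EuclideanSpace.complexify ∘ f) p₀‖ ^ 2) +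
            (ZP + (4 * (K : ℝ) ^ 2 * Ap ^ 2 + 4 * (K : ℝ) ^ 2 * An ^ 2)))) := by
  -- (1) constants depending on `f` and `p₀` only
  obtain ⟨C₆, hC₆0, hC₆⟩ := exists_sum_weight_mul_norm_sq_mFourierCoeff_le hf
  obtain ⟨L, hL0, hL⟩ := exists_sum_inv_weight_cube_le
  have hfi : Integrable f volume := hf.integrable
  have hfhC : Torus.IsConjSymm (fun k => mFourierCoeff (EuclideanSpace.complexify ∘ f) k) :=
    Torus.isConjSymm_mFourierCoeff hfi
  have hfhT : ∀ κ : Fin 3 → ℤ, ∑ j, (κ j : ℂ) * mFourierCoeff (EuclideanSpace.complexify ∘ f) κ j = 0 :=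
    fun κ => hdiv.isTransversal_mFourierCoeff hf {κ} κ (Finset.mem_singleton_self κ)
  generalize hw₀ : mFourierCoeff (EuclideanSpace.complexify ∘ f) p₀ = w₀
  have hp₀w : ∑ j, (p₀ j : ℂ) * w₀ j = 0 := by rw [← hw₀]; exact hfhT p₀
  refine ⟨(inner ℂ (mFourierCoeff (EuclideanSpace.complexify ∘ f) p₀) (IntermittentBeltrami.curlCoeff (fun _ => w₀) p₀)).re +
      (inner ℂ (mFourierCoeff (EuclideanSpace.complexify ∘ f) (-p₀))
        (IntermittentBeltrami.curlCoeff (fun _ => EuclideanSpace.conjVec w₀) (-p₀))).re,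
    (inner ℂ w₀ ((-(((4 * Real.pi ^ 2 * Torus.freqNormSq p₀ : ℝ) : ℂ))) •
        IntermittentBeltrami.curlCoeff (fun _ => w₀) p₀)).re +
      (inner ℂ (EuclideanSpace.conjVec w₀) ((-(((4 * Real.pi ^ 2 * Torus.freqNormSq (-p₀) : ℝ) : ℂ))) •
        IntermittentBeltrami.curlCoeff (fun _ => EuclideanSpace.conjVec w₀) (-p₀))).re,
    64 * L + C₆ / 4 + (1 + Torus.freqNormSq p₀) ^ 5 * ((4 * Real.pi ^ 2 * Torus.freqNormSq p₀) ^ 2 * ‖w₀‖ ^ 2) / 2,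
    (by have h0 : 0 ≤ Torus.freqNormSq p₀ := Torus.freqNormSq_nonneg p₀; positivity),
    fun N K ν hν0 hν1 hK hKN hN2 hp₀N => ?_⟩
  -- (2) the punctured ball
  have hS : ∀ k ∈ (Torus.freqBall N).erase (0 : Fin 3 → ℤ), -k ∈ (Torus.freqBall N).erase (0 : Fin 3 → ℤ) :=
    neg_mem_freqBall_erase_zero
  have hmemS : ∀ k : Fin 3 → ℤ, k ≠ 0 → Torus.freqNormSq k ≤ (N : ℝ) ^ 2 → k ∈ (Torus.freqBall N).erase 0 :=
    fun k hk hkN => Finset.mem_erase.2 ⟨hk, Torus.mem_freqBall.2 hkN⟩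
  have hp₀S : p₀ ∈ (Torus.freqBall N).erase 0 := hmemS p₀ hp₀ hp₀N
  have hnp₀S : -p₀ ∈ (Torus.freqBall N).erase 0 := hS p₀ hp₀S
  have hN2R : (2 : ℝ) ≤ (N : ℝ) ^ 2 := by
    have h2 : (2 : ℝ) ≤ N := by exact_mod_cast hN2
    nlinarith
  -- (3) the residual force `T = f̂ - (4π²|κ|² ν) • m`
  obtain ⟨T, hT⟩ : ∃ T : (Fin 3 → ℤ) → EuclideanSpace ℂ (Fin 3), T = fun κ =>
      mFourierCoeff (EuclideanSpace.complexify ∘ f) κ -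
        ((((4 * Real.pi ^ 2 * Torus.freqNormSq κ : ℝ) : ℂ)) * (ν : ℂ)) •
          (Pi.single p₀ w₀ + Pi.single (-p₀) (EuclideanSpace.conjVec w₀) : (Fin 3 → ℤ) → EuclideanSpace ℂ (Fin 3)) κ :=
    ⟨_, rfl⟩
  have hTC : Torus.IsConjSymm T := by
    rw [hT]
    exact hfhC.sub (isConjSymm_smul_of_even (isConjSymm_pair p₀ w₀) (fun κ => 4 * Real.pi ^ 2 * Torus.freqNormSq κ)
      freqWeight_even ν)
  have hTT : ∀ κ, ∑ j, (κ j : ℂ) * T κ j = 0 := fun κ => by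
    rw [hT]
    exact sum_mul_sub_eq_zero (hfhT κ) (sum_mul_smul_apply_eq_zero _ (sum_mul_pair_apply_eq_zero hp₀w κ))
  -- (4) packet wavevectors and amplitudes
  choose! k₁ k₂ hk using exists_packetWavevectors
  have hamp : ∀ q : Fin 3 → ℤ, q ≠ 0 → ∃ x₁ y₁ x₂ y₂ : EuclideanSpace ℂ (Fin 3),
      (∑ j, (k₁ q j : ℂ) * x₁ j = 0 ∧ ∑ j, (k₁ q j : ℂ) * y₁ j = 0 ∧ ∑ j, (q j : ℂ) * y₁ j = 0) ∧
      (∑ j, (k₂ q j : ℂ) * x₂ j = 0 ∧ ∑ j, (k₂ q j : ℂ) * y₂ j = 0 ∧ ∑ j, (q j : ℂ) * y₂ j = 0) ∧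
      ((∃ (a : ℂ) (v : EuclideanSpace ℝ (Fin 3)), x₁ = a • EuclideanSpace.complexify v) ∧
        (∃ (a : ℂ) (v : EuclideanSpace ℝ (Fin 3)), y₁ = a • EuclideanSpace.complexify v) ∧
        (∃ (a : ℂ) (v : EuclideanSpace ℝ (Fin 3)), x₂ = a • EuclideanSpace.complexify v) ∧
        (∃ (a : ℂ) (v : EuclideanSpace ℝ (Fin 3)), y₂ = a • EuclideanSpace.complexify v)) ∧
      (4 * Real.pi * I * ∑ j, conj (x₁ j) * (q j : ℂ)) • y₁ +
          (4 * Real.pi * I * ∑ j, conj (x₂ j) * (q j : ℂ)) • y₂ = (2⁻¹ : ℂ) • T q ∧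
      (‖x₁‖ ^ 2 ≤ 4 / (1 + Torus.freqNormSq q) ^ 3 ∧ ‖x₂‖ ^ 2 ≤ 4 / (1 + Torus.freqNormSq q) ^ 3 ∧
        ‖y₁‖ ^ 2 ≤ ‖(2⁻¹ : ℂ) • T q‖ ^ 2 * (1 + Torus.freqNormSq q) ^ 4 / 16 ∧
        ‖y₂‖ ^ 2 ≤ ‖(2⁻¹ : ℂ) • T q‖ ^ 2 * (1 + Torus.freqNormSq q) ^ 4 / 16) :=
    fun q hq => exists_packetAmplitudes hq (hk q hq).1.2.2.2.1 (hk q hq).2.1.2.2.2.1 (hk q hq).2.2 _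
      (sum_mul_smul_apply_eq_zero _ (hTT q))
  choose! X₁ Y₁ X₂ Y₂ hXY using hamp
  -- (5) the packet data selected by `j : Bool` (`true ↦` first packet, `false ↦` second packet)
  have hpk : ∀ q : Fin 3 → ℤ, q ∈ (Torus.freqBall N).erase 0 → ∀ j : Bool,
      ((if j then k₁ q else k₂ q) ∈ (Torus.freqBall N).erase 0 ∧
        (if j then k₁ q else k₂ q) + q ∈ (Torus.freqBall N).erase 0 ∧
        -(if j then k₁ q else k₂ q) ∈ (Torus.freqBall N).erase 0 ∧
        -((if j then k₁ q else k₂ q) + q) ∈ (Torus.freqBall N).erase 0) ∧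
      ((if j then k₁ q else k₂ q) ≠ 0 ∧ (if j then k₁ q else k₂ q) + q ≠ 0 ∧ q ≠ 0 ∧
        (2 : ℕ) • (if j then k₁ q else k₂ q) + q ≠ 0) ∧
      (∑ i, ((if j then k₁ q else k₂ q) i : ℂ) * (if j then X₁ q else X₂ q) i = 0 ∧
        ∑ i, ((if j then k₁ q else k₂ q) i : ℂ) * (if j then Y₁ q else Y₂ q) i = 0 ∧
        ∑ i, (q i : ℂ) * (if j then Y₁ q else Y₂ q) i = 0) ∧
      ((∃ (a : ℂ) (v : EuclideanSpace ℝ (Fin 3)), (if j then X₁ q else X₂ q) = a • EuclideanSpace.complexify v) ∧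
        (∃ (a : ℂ) (v : EuclideanSpace ℝ (Fin 3)), (if j then Y₁ q else Y₂ q) = a • EuclideanSpace.complexify v)) ∧
      (Torus.freqNormSq (if j then k₁ q else k₂ q) ≤ 2 ∧
        Torus.freqNormSq ((if j then k₁ q else k₂ q) + q) ≤ 1 + Torus.freqNormSq q ∧
        ‖(if j then X₁ q else X₂ q)‖ ^ 2 ≤ 4 / (1 + Torus.freqNormSq q) ^ 3 ∧
        ‖(if j then Y₁ q else Y₂ q)‖ ^ 2 ≤ ‖(2⁻¹ : ℂ) • T q‖ ^ 2 * (1 + Torus.freqNormSq q) ^ 4 / 16) := by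
    intro q hqS j
    have hq : q ≠ 0 := (Finset.mem_erase.1 hqS).1
    have hqN : Torus.freqNormSq q ≤ (N : ℝ) ^ 2 := Torus.mem_freqBall.1 (Finset.mem_erase.1 hqS).2
    obtain ⟨⟨h1a, h1b, h1c, h1d, h1e⟩, ⟨h2a, h2b, h2c, h2d, h2e⟩, -⟩ := hk q hq
    obtain ⟨⟨t1x, t1y, t1q⟩, ⟨t2x, t2y, t2q⟩, ⟨p1x, p1y, p2x, p2y⟩, -, ⟨b1x, b2x, b1y, b2y⟩⟩ := hXY q hq
    cases j
    · simp only [Bool.false_eq_true, ↓reduceIte]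
      refine ⟨⟨hmemS _ h2a (h2d.trans hN2R), hmemS _ h2b (h2e.trans hqN), hS _ (hmemS _ h2a (h2d.trans hN2R)),
        hS _ (hmemS _ h2b (h2e.trans hqN))⟩, ⟨h2a, h2b, hq, h2c⟩, ⟨t2x, t2y, t2q⟩, ⟨p2x, p2y⟩,
        ⟨h2d, h2e.trans (by linarith), b2x, b2y⟩⟩
    · simp only [↓reduceIte]
      refine ⟨⟨hmemS _ h1a (h1d.trans hN2R), hmemS _ h1b (h1e.trans hqN), hS _ (hmemS _ h1a (h1d.trans hN2R)),
        hS _ (hmemS _ h1b (h1e.trans hqN))⟩, ⟨h1a, h1b, hq, h1c⟩, ⟨t1x, t1y, t1q⟩, ⟨p1x, p1y⟩,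
        ⟨h1d, h1e.trans (by linarith), b1x, b1y⟩⟩
  -- (6) the packet pieces, their enstrophy and energy
  generalize hPk : (fun p : ↥((Torus.freqBall N).erase (0 : Fin 3 → ℤ)) × Bool × Bool =>
      let q : Fin 3 → ℤ := p.1
      let k : Fin 3 → ℤ := if p.2.1 then k₁ q else k₂ q
      let φ : ℂ := if p.2.2 then 1 else I
      let x : EuclideanSpace ℂ (Fin 3) := if p.2.1 then X₁ q else X₂ q
      let y : EuclideanSpace ℂ (Fin 3) := if p.2.1 then Y₁ q else Y₂ q
      ((Pi.single k (φ • x) + Pi.single (-k) (EuclideanSpace.conjVec (φ • x))) +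
        (Pi.single (k + q) (φ • y) + Pi.single (-(k + q)) (EuclideanSpace.conjVec (φ • y))) :
          (Fin 3 → ℤ) → EuclideanSpace ℂ (Fin 3))) = Pk
  -- unfolding the packet pieces
  have hPkp : ∀ p : ↥((Torus.freqBall N).erase (0 : Fin 3 → ℤ)) × Bool × Bool, Pk p =
      (let q : Fin 3 → ℤ := p.1
       let k : Fin 3 → ℤ := if p.2.1 then k₁ q else k₂ q
       let φ : ℂ := if p.2.2 then 1 else I
       let x : EuclideanSpace ℂ (Fin 3) := if p.2.1 then X₁ q else X₂ q
       let y : EuclideanSpace ℂ (Fin 3) := if p.2.1 then Y₁ q else Y₂ q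
       ((Pi.single k (φ • x) + Pi.single (-k) (EuclideanSpace.conjVec (φ • x))) +
         (Pi.single (k + q) (φ • y) + Pi.single (-(k + q)) (EuclideanSpace.conjVec (φ • y))) :
           (Fin 3 → ℤ) → EuclideanSpace ℂ (Fin 3))) := fun p => by rw [← hPk]
  have hPkC : ∀ p, Torus.IsConjSymm (Pk p) := fun p => by
    rw [hPkp]; dsimp only; exact isConjSymm_packetPiece _ _ _ _ _
  have hPkT : ∀ p, Torus.IsTransversal ((Torus.freqBall N).erase 0) (Pk p) := fun p => by
    obtain ⟨-, -, ⟨hxk, hyk, hyq⟩, -⟩ := hpk p.1 p.1.2 p.2.1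
    rw [hPkp]; dsimp only; exact isTransversal_packetPiece _ _ hxk hyk hyq
  have hPkZ : ∀ p : ↥((Torus.freqBall N).erase (0 : Fin 3 → ℤ)) × Bool × Bool,
      ∑ κ ∈ (Torus.freqBall N).erase 0, Torus.freqNormSq κ * ‖Pk p κ‖ ^ 2 =
        2 * (Torus.freqNormSq (if p.2.1 then k₁ (p.1 : Fin 3 → ℤ) else k₂ (p.1 : Fin 3 → ℤ)) *
          ‖(if p.2.1 then X₁ (p.1 : Fin 3 → ℤ) else X₂ (p.1 : Fin 3 → ℤ))‖ ^ 2) +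
        2 * (Torus.freqNormSq ((if p.2.1 then k₁ (p.1 : Fin 3 → ℤ) else k₂ (p.1 : Fin 3 → ℤ)) + (p.1 : Fin 3 → ℤ)) *
          ‖(if p.2.1 then Y₁ (p.1 : Fin 3 → ℤ) else Y₂ (p.1 : Fin 3 → ℤ))‖ ^ 2) := fun p => by
    obtain ⟨⟨hk, hkq, hnk, hnkq⟩, ⟨hk0, hkq0, hq, h2kq⟩, -⟩ := hpk p.1 p.1.2 p.2.1
    rw [hPkp]; dsimp only; exact enstrophy_packetPiece hk hkq hnk hnkq hk0 hkq0 hq h2kq (norm_phase _)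
  have hPkE : ∀ p : ↥((Torus.freqBall N).erase (0 : Fin 3 → ℤ)) × Bool × Bool,
      ∑ κ ∈ (Torus.freqBall N).erase 0, ‖Pk p κ‖ ^ 2 =
        2 * ‖(if p.2.1 then X₁ (p.1 : Fin 3 → ℤ) else X₂ (p.1 : Fin 3 → ℤ))‖ ^ 2 +
        2 * ‖(if p.2.1 then Y₁ (p.1 : Fin 3 → ℤ) else Y₂ (p.1 : Fin 3 → ℤ))‖ ^ 2 := fun p => by
    obtain ⟨⟨hk, hkq, hnk, hnkq⟩, ⟨hk0, hkq0, hq, h2kq⟩, -⟩ := hpk p.1 p.1.2 p.2.1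
    rw [hPkp]; dsimp only; exact energy_packetPiece hk hkq hnk hnkq hk0 hkq0 hq h2kq (norm_phase _)
  have hPkH : ∀ p : ↥((Torus.freqBall N).erase (0 : Fin 3 → ℤ)) × Bool × Bool,
      ∑ κ ∈ (Torus.freqBall N).erase 0, (inner ℂ (Pk p κ) (-((((4 * Real.pi ^ 2 * Torus.freqNormSq κ : ℝ) : ℂ)) •
        IntermittentBeltrami.curlCoeff (Pk p) κ))).re = 0 := fun p => by
    obtain ⟨⟨hk, hkq, hnk, hnkq⟩, ⟨hk0, hkq0, hq, h2kq⟩, -, ⟨hx, hy⟩, -⟩ := hpk p.1 p.1.2 p.2.1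
    rw [hPkp]; dsimp only; exact helicity_packetPiece hk hkq hnk hnkq hk0 hkq0 hq h2kq hx hy
  -- the residual bound `‖T q‖² ≤ 2‖f̂ q‖² + 2 (4π²|q|²)² ‖m q‖²`
  have hTq : ∀ q : Fin 3 → ℤ, ‖T q‖ ^ 2 ≤ 2 * ‖mFourierCoeff (EuclideanSpace.complexify ∘ f) q‖ ^ 2 +
      2 * ((4 * Real.pi ^ 2 * Torus.freqNormSq q) ^ 2 *
        ‖(Pi.single p₀ w₀ + Pi.single (-p₀) (EuclideanSpace.conjVec w₀) : (Fin 3 → ℤ) → EuclideanSpace ℂ (Fin 3)) q‖ ^ 2) := by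
    intro q
    rw [hT]
    refine norm_sq_sub_smul_le _ _ ?_
    have h0 : 0 ≤ 4 * Real.pi ^ 2 * Torus.freqNormSq q := mul_nonneg (by positivity) (Torus.freqNormSq_nonneg q)
    rw [norm_mul, Complex.norm_real, Complex.norm_real, Real.norm_of_nonneg h0, Real.norm_of_nonneg hν0]
    exact mul_le_of_le_one_right h0 hν1
  -- per-packet enstrophy bound
  have hbq : ∀ p : ↥((Torus.freqBall N).erase (0 : Fin 3 → ℤ)) × Bool × Bool,
      ∑ κ ∈ (Torus.freqBall N).erase 0, Torus.freqNormSq κ * ‖Pk p κ‖ ^ 2 ≤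
        16 * ((1 + Torus.freqNormSq (p.1 : Fin 3 → ℤ)) ^ 3)⁻¹ +
          (1 + Torus.freqNormSq (p.1 : Fin 3 → ℤ)) ^ 5 *
            (‖mFourierCoeff (EuclideanSpace.complexify ∘ f) (p.1 : Fin 3 → ℤ)‖ ^ 2 +
              (4 * Real.pi ^ 2 * Torus.freqNormSq (p.1 : Fin 3 → ℤ)) ^ 2 *
                ‖(Pi.single p₀ w₀ + Pi.single (-p₀) (EuclideanSpace.conjVec w₀) :
                  (Fin 3 → ℤ) → EuclideanSpace ℂ (Fin 3)) (p.1 : Fin 3 → ℤ)‖ ^ 2) / 16 := by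
    intro p
    obtain ⟨-, -, -, -, ⟨hk2, hkq, hx, hy⟩⟩ := hpk p.1 p.1.2 p.2.1
    rw [hPkZ p]
    rw [norm_sq_half_smul] at hy
    have h3 := hTq (p.1 : Fin 3 → ℤ)
    exact packet_cost (by linarith [Torus.freqNormSq_nonneg (p.1 : Fin 3 → ℤ)]) (sq_nonneg _) (sq_nonneg _) hk2 hx
      hkq hy (by linarith)
  refine ⟨∑ p, ∑ κ ∈ (Torus.freqBall N).erase 0, Torus.freqNormSq κ * ‖Pk p κ‖ ^ 2,
    ∑ p, ∑ κ ∈ (Torus.freqBall N).erase 0, ‖Pk p κ‖ ^ 2,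
    Finset.sum_nonneg fun p _ => Finset.sum_nonneg fun κ _ => sq_nonneg _,
    Finset.sum_le_sum fun p _ => Finset.sum_le_sum fun κ hκ =>
      le_mul_of_one_le_left (sq_nonneg _) (Torus.one_le_freqNormSq (Finset.mem_erase.1 hκ).1), ?_, ?_⟩
  · -- the uniform bound `ZP ≤ C`
    refine (Finset.sum_le_sum fun p _ => hbq p).trans ?_
    rw [Fintype.sum_prod_type]
    dsimp only
    have hcs := Finset.sum_coe_sort ((Torus.freqBall N).erase 0) (fun q : Fin 3 → ℤ => ∑ jb : Bool × Bool,
        (16 * ((1 + Torus.freqNormSq q) ^ 3)⁻¹ + (1 + Torus.freqNormSq q) ^ 5 *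
          (‖mFourierCoeff (EuclideanSpace.complexify ∘ f) q‖ ^ 2 + (4 * Real.pi ^ 2 * Torus.freqNormSq q) ^ 2 *
            ‖(Pi.single p₀ w₀ + Pi.single (-p₀) (EuclideanSpace.conjVec w₀) :
              (Fin 3 → ℤ) → EuclideanSpace ℂ (Fin 3)) q‖ ^ 2) / 16))
    rw [hcs]
    simp only [Finset.sum_const, Finset.card_univ, Fintype.card_prod, Fintype.card_bool, nsmul_eq_mul, Nat.cast_mul,
      Nat.cast_ofNat]
    have e3 := sum_weight_mul_norm_sq_pair hp₀ hp₀S hnp₀S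
      (fun q => (1 + Torus.freqNormSq q) ^ 5 * (4 * Real.pi ^ 2 * Torus.freqNormSq q) ^ 2)
      (by simp only [Torus.freqNormSq_neg]) w₀
    have e2 : ∑ q ∈ (Torus.freqBall N).erase 0, (1 + Torus.freqNormSq q) ^ 5 *
        ‖mFourierCoeff (EuclideanSpace.complexify ∘ f) q‖ ^ 2 ≤ C₆ :=
      le_trans (Finset.sum_le_sum fun q _ => mul_le_mul_of_nonneg_right
        (pow_le_pow_right₀ (by linarith [Torus.freqNormSq_nonneg q]) (by norm_num)) (sq_nonneg _)) (hC₆ _)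
    have e1 := hL ((Torus.freqBall N).erase 0)
    calc ∑ q ∈ (Torus.freqBall N).erase 0, 2 * 2 * (16 * ((1 + Torus.freqNormSq q) ^ 3)⁻¹ +
          (1 + Torus.freqNormSq q) ^ 5 * (‖mFourierCoeff (EuclideanSpace.complexify ∘ f) q‖ ^ 2 +
            (4 * Real.pi ^ 2 * Torus.freqNormSq q) ^ 2 *
              ‖(Pi.single p₀ w₀ + Pi.single (-p₀) (EuclideanSpace.conjVec w₀) :
                (Fin 3 → ℤ) → EuclideanSpace ℂ (Fin 3)) q‖ ^ 2) / 16)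
        = 64 * ∑ q ∈ (Torus.freqBall N).erase 0, ((1 + Torus.freqNormSq q) ^ 3)⁻¹ +
            (∑ q ∈ (Torus.freqBall N).erase 0, (1 + Torus.freqNormSq q) ^ 5 *
              ‖mFourierCoeff (EuclideanSpace.complexify ∘ f) q‖ ^ 2) / 4 +
            (∑ q ∈ (Torus.freqBall N).erase 0, ((1 + Torus.freqNormSq q) ^ 5 * (4 * Real.pi ^ 2 * Torus.freqNormSq q) ^ 2) *
              ‖(Pi.single p₀ w₀ + Pi.single (-p₀) (EuclideanSpace.conjVec w₀) :
                (Fin 3 → ℤ) → EuclideanSpace ℂ (Fin 3)) q‖ ^ 2) / 4 := by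
          rw [Finset.mul_sum, Finset.sum_div, Finset.sum_div, ← Finset.sum_add_distrib, ← Finset.sum_add_distrib]
          refine Finset.sum_congr rfl fun q _ => ?_
          ring
      _ ≤ 64 * L + C₆ / 4 +
            (2 * (((1 + Torus.freqNormSq p₀) ^ 5 * (4 * Real.pi ^ 2 * Torus.freqNormSq p₀) ^ 2) * ‖w₀‖ ^ 2)) / 4 := by
          rw [e3]
          gcongr
      _ = 64 * L + C₆ / 4 + (1 + Torus.freqNormSq p₀) ^ 5 * ((4 * Real.pi ^ 2 * Torus.freqNormSq p₀) ^ 2 * ‖w₀‖ ^ 2) / 2 := by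
          ring
  -- (7) the sea pieces and the atom cloud
  intro Ap An
  generalize hQ : (fun b : Bool =>
      let A : ℝ := if b then Ap else An
      let σ : ℝ := if b then 1 else -1
      let ks : Fin 3 → ℤ := ![(K : ℤ), 0, 0]
      (Pi.single ks ((A : ℂ) • !₂[(0 : ℂ), 1, σ * I]) +
        Pi.single (-ks) (EuclideanSpace.conjVec ((A : ℂ) • !₂[(0 : ℂ), 1, σ * I])) :
          (Fin 3 → ℤ) → EuclideanSpace ℂ (Fin 3))) = Q
  have hQp : ∀ b : Bool, Q b =
      (let A : ℝ := if b then Ap else An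
       let σ : ℝ := if b then 1 else -1
       let ks : Fin 3 → ℤ := ![(K : ℤ), 0, 0]
       (Pi.single ks ((A : ℂ) • !₂[(0 : ℂ), 1, σ * I]) +
         Pi.single (-ks) (EuclideanSpace.conjVec ((A : ℂ) • !₂[(0 : ℂ), 1, σ * I])) :
           (Fin 3 → ℤ) → EuclideanSpace ℂ (Fin 3))) := fun b => by rw [← hQ]
  have hQC : ∀ b, Torus.IsConjSymm (Q b) := fun b => by rw [hQp]; dsimp only; exact isConjSymm_seaPiece K _ _
  have hQT : ∀ b, Torus.IsTransversal ((Torus.freqBall N).erase 0) (Q b) := fun b => by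
    rw [hQp]; dsimp only; exact isTransversal_seaPiece _ K _ _
  have hQself : ∀ b, Torus.convectionCoeff ((Torus.freqBall N).erase 0) (Q b) (Q b) = 0 := fun b => by
    rw [hQp]; dsimp only; exact convectionCoeff_seaPiece _ K _ _
  have hQZ : ∀ b : Bool, ∑ κ ∈ (Torus.freqBall N).erase 0, Torus.freqNormSq κ * ‖Q b κ‖ ^ 2 =
      4 * (K : ℝ) ^ 2 * (if b then Ap else An) ^ 2 := fun b => by
    rw [hQp]; dsimp only
    exact enstrophy_seaPiece hK hKN _ (by cases b <;> simp)
  have hQE : ∀ b : Bool, ∑ κ ∈ (Torus.freqBall N).erase 0, ‖Q b κ‖ ^ 2 = 4 * (if b then Ap else An) ^ 2 := fun b => by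
    rw [hQp]; dsimp only
    exact energy_seaPiece hK hKN _ (by cases b <;> simp)
  have hQH : ∀ b : Bool, ∑ κ ∈ (Torus.freqBall N).erase 0, (inner ℂ (Q b κ)
      (-((((4 * Real.pi ^ 2 * Torus.freqNormSq κ : ℝ) : ℂ)) • IntermittentBeltrami.curlCoeff (Q b) κ))).re =
      -(if b then (1 : ℝ) else -1) * (32 * Real.pi ^ 3 * (K : ℝ) ^ 3 * (if b then Ap else An) ^ 2) := fun b => by
    rw [hQp]; dsimp only
    exact helicity_seaPiece hK hKN _ _
  -- the Reynolds-stress balance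
  have hlin : ∀ κ ∈ (Torus.freqBall N).erase 0,
      ∑ i, Torus.convectionCoeff ((Torus.freqBall N).erase 0) (Sum.elim Pk Q i) (Sum.elim Pk Q i) κ =
        mFourierCoeff (EuclideanSpace.complexify ∘ f) κ -
          (((4 * Real.pi ^ 2 * Torus.freqNormSq κ : ℝ) : ℂ) * (ν : ℂ)) •
            (Pi.single p₀ w₀ + Pi.single (-p₀) (EuclideanSpace.conjVec w₀) : (Fin 3 → ℤ) → EuclideanSpace ℂ (Fin 3)) κ := by
    intro κ hκ
    rw [Fintype.sum_sum_type]
    simp only [Sum.elim_inl, Sum.elim_inr]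
    rw [Fintype.sum_bool, hQself, hQself, Pi.zero_apply, add_zero, add_zero]
    -- the packets, momentum by momentum
    have hpair : ∀ (q : ↥((Torus.freqBall N).erase (0 : Fin 3 → ℤ))) (j : Bool),
        Torus.convectionCoeff ((Torus.freqBall N).erase 0) (Pk (q, j, true)) (Pk (q, j, true)) κ +
          Torus.convectionCoeff ((Torus.freqBall N).erase 0) (Pk (q, j, false)) (Pk (q, j, false)) κ =
        (Pi.single (q : Fin 3 → ℤ) ((4 * Real.pi * I * ∑ i, conj ((if j then X₁ (q : Fin 3 → ℤ) else X₂ (q : Fin 3 → ℤ)) i) *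
              ((q : Fin 3 → ℤ) i : ℂ)) • (if j then Y₁ (q : Fin 3 → ℤ) else Y₂ (q : Fin 3 → ℤ))) +
          Pi.single (-(q : Fin 3 → ℤ)) (EuclideanSpace.conjVec ((4 * Real.pi * I *
            ∑ i, conj ((if j then X₁ (q : Fin 3 → ℤ) else X₂ (q : Fin 3 → ℤ)) i) * ((q : Fin 3 → ℤ) i : ℂ)) •
              (if j then Y₁ (q : Fin 3 → ℤ) else Y₂ (q : Fin 3 → ℤ)))) : (Fin 3 → ℤ) → EuclideanSpace ℂ (Fin 3)) κ := by
      intro q j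
      obtain ⟨⟨hk, hkq, hnk, hnkq⟩, -, ⟨hxk, hyk, hyq⟩, -⟩ := hpk q q.2 j
      rw [hPkp, hPkp, ← Pi.add_apply]
      dsimp only
      simp only [Bool.false_eq_true, ↓reduceIte, one_smul]
      rw [packet_stress hk hkq hnk hnkq hxk hyk hyq]
    have hq2 : ∀ q : ↥((Torus.freqBall N).erase (0 : Fin 3 → ℤ)),
        ∑ jb : Bool × Bool, Torus.convectionCoeff ((Torus.freqBall N).erase 0) (Pk (q, jb)) (Pk (q, jb)) κ =
          (Pi.single (q : Fin 3 → ℤ) ((2⁻¹ : ℂ) • T q) +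
            Pi.single (-(q : Fin 3 → ℤ)) (EuclideanSpace.conjVec ((2⁻¹ : ℂ) • T q)) :
              (Fin 3 → ℤ) → EuclideanSpace ℂ (Fin 3)) κ := by
      intro q
      rw [Fintype.sum_prod_type]
      simp_rw [Fintype.sum_bool]
      rw [hpair q true, hpair q false, ← Pi.add_apply, pair_add_pair]
      simp only [↓reduceIte, Bool.false_eq_true]
      rw [(hXY q (Finset.mem_erase.1 q.2).1).2.2.2.1]
    rw [Fintype.sum_prod_type]
    simp_rw [hq2]
    have hcs := Finset.sum_coe_sort ((Torus.freqBall N).erase 0) (fun q : Fin 3 → ℤ => (Pi.single q ((2⁻¹ : ℂ) • T q) +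
          Pi.single (-q) (EuclideanSpace.conjVec ((2⁻¹ : ℂ) • T q)) : (Fin 3 → ℤ) → EuclideanSpace ℂ (Fin 3)) κ)
    rw [hcs, sum_pair_half_apply hS hTC hκ, hT]
  have hAC : ∀ i, Torus.IsConjSymm (Sum.elim Pk Q i) := by
    rintro (p | b)
    · exact hPkC p
    · exact hQC b
  have hAT : ∀ i, Torus.IsTransversal ((Torus.freqBall N).erase 0) (Sum.elim Pk Q i) := by
    rintro (p | b)
    · exact hPkT p
    · exact hQT b
  obtain ⟨μ, hμP, hμL, hμ3, hμrows, hμE, hμH, hμEn, hμD⟩ := atoms_measure N ν hf _ (Sum.elim Pk Q)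
    (isConjSymm_pair p₀ w₀) (isTransversal_pair _ hp₀w) hAC hAT (convectionCoeff_pair_self _ hp₀w) hlin
  -- the mean-flow values
  have hLin : ∑ κ ∈ (Torus.freqBall N).erase 0, (inner ℂ (mFourierCoeff (EuclideanSpace.complexify ∘ f) κ)
      ((Pi.single p₀ w₀ + Pi.single (-p₀) (EuclideanSpace.conjVec w₀) : (Fin 3 → ℤ) → EuclideanSpace ℂ (Fin 3)) κ)).re =
      2 * ‖w₀‖ ^ 2 := by
    rw [sum_re_inner_pair hp₀ hp₀S hnp₀S hfhC w₀, hw₀, re_inner_self]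
  have hZm := sum_freqNormSq_mul_norm_sq_pair hp₀ hp₀S hnp₀S w₀
  have hEm := sum_norm_sq_pair hp₀ hp₀S hnp₀S w₀
  have hLinH := sum_re_inner_curlCoeff_pair hp₀ hp₀S hnp₀S (fun k => mFourierCoeff (EuclideanSpace.complexify ∘ f) k) w₀
  have hHelm : ∑ κ ∈ (Torus.freqBall N).erase 0, (inner ℂ
      ((Pi.single p₀ w₀ + Pi.single (-p₀) (EuclideanSpace.conjVec w₀) : (Fin 3 → ℤ) → EuclideanSpace ℂ (Fin 3)) κ)
      (-((((4 * Real.pi ^ 2 * Torus.freqNormSq κ : ℝ) : ℂ)) • IntermittentBeltrami.curlCoeff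
        (Pi.single p₀ w₀ + Pi.single (-p₀) (EuclideanSpace.conjVec w₀) : (Fin 3 → ℤ) → EuclideanSpace ℂ (Fin 3)) κ))).re =
      (inner ℂ w₀ ((-(((4 * Real.pi ^ 2 * Torus.freqNormSq p₀ : ℝ) : ℂ))) •
        IntermittentBeltrami.curlCoeff (fun _ => w₀) p₀)).re +
      (inner ℂ (EuclideanSpace.conjVec w₀) ((-(((4 * Real.pi ^ 2 * Torus.freqNormSq (-p₀) : ℝ) : ℂ))) •
        IntermittentBeltrami.curlCoeff (fun _ => EuclideanSpace.conjVec w₀) (-p₀))).re := by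
    simp_rw [← neg_smul]
    exact sum_re_inner_smul_curlCoeff_pair hp₀ hp₀S hnp₀S _ w₀
  refine ⟨μ, hμP, hμL, hμ3, hμrows, ⟨hμE.1, ?_⟩, ⟨hμH.1, ?_⟩, ?_, ?_⟩
  · rw [hμE.2, hLin, hZm, Fintype.sum_sum_type]
    simp only [Sum.elim_inl, Sum.elim_inr]
    rw [Fintype.sum_bool, hQZ, hQZ]
    simp only [↓reduceIte, Bool.false_eq_true]
  · rw [hμH.2, hLinH, hHelm, Fintype.sum_sum_type]
    simp only [Sum.elim_inl, Sum.elim_inr]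
    rw [Fintype.sum_bool, hQH, hQH, Finset.sum_eq_zero fun p _ => hPkH p]
    simp only [↓reduceIte, Bool.false_eq_true, zero_add]
  · rw [hμEn, hEm, Fintype.sum_sum_type]
    simp only [Sum.elim_inl, Sum.elim_inr]
    rw [Fintype.sum_bool, hQE, hQE]
    simp only [↓reduceIte, Bool.false_eq_true]
  · rw [hμD, hZm, Fintype.sum_sum_type]
    simp only [Sum.elim_inl, Sum.elim_inr]
    rw [Fintype.sum_bool, hQZ, hQZ]
    simp only [↓reduceIte, Bool.false_eq_true]

/-- **Registered sub-goal `balancedMenu_design` of stub S5 `stub_balancedMenu`** (summary of this file):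
the balanced menu design — mean flow, stress packets, chiral sea — and its rows. [folklore] -/
theorem balancedMenu_design : ∀ (f : T3 → R3) (p₀ : Fin 3 → ℤ), Torus.IsSmooth f → Torus.IsDivFree f → p₀ ≠ 0 → ∃ H₀ H₁ C : ℝ, 0 ≤ C ∧ ∀ (N K : ℕ) (ν : ℝ), 0 ≤ ν → ν ≤ 1 → 1 ≤ K → K ≤ N → 2 ≤ N → Torus.freqNormSq p₀ ≤ (N : ℝ) ^ 2 → ∃ ZP EP : ℝ, 0 ≤ EP ∧ EP ≤ ZP ∧ ZP ≤ C ∧ ∀ Ap An : ℝ, ∃ μ : Measure H3, IsProbabilityMeasure μ ∧ (∀ᵐ u ∂μ, IsLevel N u) ∧ Integrable (fun u : H3 => ‖u‖ ^ 3) μ ∧ (∀ g : T3 → R3, IsBandTest N g → Integrable (fun u : H3 => Torus.nsGeneratorPairing ν f u g) μ ∧ ∫ u, Torus.nsGeneratorPairing ν f u g ∂μ = 0) ∧ (Integrable (fun u : H3 => Torus.nsGeneratorPairing ν f u (Torus.fourierTruncate N ((u : L2T3) : T3 → R3))) μ ∧ ∫ u, Torus.nsGeneratorPairing ν f u (Torus.fourierTruncate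 N ((u : L2T3) : T3 → R3)) ∂μ = 2 * ‖mFourierCoeff (EuclideanSpace.complexify ∘ f) p₀‖ ^ 2 - ν * (4 * Real.pi ^ 2 * (2 * (Torus.freqNormSq p₀ * ‖mFourierCoeff (EuclideanSpace.complexify ∘ f) p₀‖ ^ 2) + (ZP + (4 * (K : ℝ) ^ 2 * Ap ^ 2 + 4 * (K : ℝ) ^ 2 * An ^ 2))))) ∧ (Integrable (fun u : H3 => Torus.nsGeneratorPairing ν f u (BDSV.curl (Torus.fourierTruncate N ((u : L2T3) : T3 → R3)))) μ ∧ ∫ u, Torus.nsGeneratorPairing ν f u (BDSV.curl (Torus.fourierTruncate N ((u : L2T3) : T3 → R3))) ∂μ = H₀ + ν * (H₁ + (-(1 : ℝ) * (32 * Real.pi ^ 3 * (K : ℝ) ^ 3 * Ap ^ 2) + -(-1 : ℝ) * (32 * Real.pi ^ 3 * (K : ℝ) ^ 3 * An ^ 2)))) ∧ Torus.ensembleEnergy μ = 2 * ‖mFourierCoeff (EuclideanSpace.complexify ∘ f) p₀‖ ^ 2 + (EP + (4 * Ap ^ 2 + 4 * An ^ 2)) ∧ Torus.ensembleDissipation ν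 μ = ν * (4 * Real.pi ^ 2 * (2 * (Torus.freqNormSq p₀ * ‖mFourierCoeff (EuclideanSpace.complexify ∘ f) p₀‖ ^ 2) + (ZP + (4 * (K : ℝ) ^ 2 * Ap ^ 2 + 4 * (K : ℝ) ^ 2 * An ^ 2)))) :=
  fun _ _ hf hdiv hp₀ => balancedMenu_design_aux hf hdiv hp₀

end Summit.AnomalousDissipation.AnomalousDissipation.Theorems.MomentParityCubicParityLoud

end
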